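import Mathlib
import Summits.ResolutionOfSingularities.ResolutionOfSingularities.Theorems.RadicialJungCleanModelsLens5TFramePDegreeC
import HarnessLib

/-!
# Route `RadicialJung`, crux `CleanModels` (stmt-15917): CURRENCY of the T″/T‴ port (the authors' `def`s for ARBITRARY `p`-rank, verbatim)

PORT (line lead `res-B-lead-1` g8, for Sketch rev 33) of res-B-lens-5's crux workfiles `Cruxes/DescentPerfectToAll/Lens5_TPrimeInfCurrency.lean` rev 4
(crux 75ffdaa75b27; author res-B-lens-5 g14), the T″ theorem module prepared by the author from `Lens5_TPrimeInf.lean` rev 3 (HOME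
`B/res-B-lens-5/g14/PORTALPHA_TPrimeInf_theorem_module.lean`, sha16 48c5cb0bf6ec7b34, certified by the author's one-file simulation) and
`Cruxes/DescentPerfectToAll/Lens5_TPrimeConst.lean` rev 1 (4e5e6a0028c2): THEOREMS T′_∞ / T″ / T‴ — the slice {`[Γ:pΓ] = p²`, `K/k′` separably
generated and `κ_v/k′` SEPARABLE for some finite intermediate field of constants `k ⊆ k′ ⊆ K`} of the research stub `stub_cleanLU3DefectNonDiscrete`
(grounds of ARBITRARY, possibly infinite, `p`-rank), modulo F-02 `CossartPiltant2019` and F-32 (`hEmb`) only.  Continues the T⁗-family port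
(`…Lens5TFrame{Currency,…,PDegreeC}`): same namespace `Summit.ResolutionOfSingularities.ResolutionOfSingularities.Theorems.RadicialJungCleanModels.Lens5TFrame`,
declarations VERBATIM; the authors' copies of §B/§B′ (defs) and §C/§D (RG/IR lemmas) are NOT repeated — they are the landed `…Lens5TFrameCurrency` /
`…Lens5TFrameRG` / `…Lens5TFrameIR` declarations of the same names and statements; §C′/§B‴ (unused bridges) and the T′_fin/T′₁/«T″ ⊇ T» corollaries are not ported.
OURS · counted 0 · nothing here proves resolution in characteristic `p`.

This module: `IsPSpanningFamilyInf`, `ResiduallyPIndependentFamilyInf`, `CleanLU3DefectPRankTwoSepInfAt` (+ the restriction / finite-type conversions), `CleanLU3DefectPRankTwoSepResAt` (T″), `CleanLU3DefectPRankTwoSepConstAt` (T‴) — definitions (review-queued per D-0009) and three one-line conversions.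
-/

set_option linter.dupNamespace false -- mandated namespace of this single-conjunct summit

noncomputable section

section

open IsLocalRing
open Literature.AlgebraicGeometry.Resolution
open Summit.ResolutionOfSingularities.ResolutionOfSingularities.Theorems.RadicialJung.CleanModels
open Summit.ResolutionOfSingularities.ResolutionOfSingularities.Theorems.RadicialJung.CleanModels.Lens5
open Summit.ResolutionOfSingularities.ResolutionOfSingularities.Theorems.RadicialJung.CleanModels.Lens5.PRankTwoCurrency
open Summit.ResolutionOfSingularities.ResolutionOfSingularities.Theorems.RadicialJung.CleanModels.Lens5.PRankTwoAssembly
open Summit.ResolutionOfSingularities.ResolutionOfSingularities.Theorems.RadicialJungCleanModels.Lens5RegularityCriterion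
open Summit.ResolutionOfSingularities.ResolutionOfSingularities.Theorems.RadicialJungCleanModels.Lens5ChartSurjection

namespace Summit.ResolutionOfSingularities.ResolutionOfSingularities.Theorems.RadicialJungCleanModels.Lens5TFrame

/-! ### §B″ Currency of T′_∞ (ARBITRARY `p`-rank, new in this file): a `p`-spanning family of `k` indexed by ANY type `S`, residually
`p`-independent along `v` on every finite subfamily; all sums finitely supported -/

/-- **A `p`-spanning family of `k` indexed by an arbitrary type**: every `c ∈ k` is a FINITE sum `Σ_{s ∈ s₀} d_s^p b_s`.  EVERY field of
characteristic `p` has one (the monomials with exponents `< p` in a `p`-basis — or simply `b := id`); `S` must be infinite iff `[k : k^p] = ∞`. [folklore] -/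
def IsPSpanningFamilyInf (p : ℕ) {k : Type} [Field k] {S : Type} (b : S → k) : Prop :=
    ∀ c : k, ∃ (s : Finset S) (d : S → k), c = ∑ i ∈ s, d i ^ p * b i

/-- **Residual `p`-independence of an arbitrary family** `B : S → K` along `v` (in-`K` form): on every finite `s₀ ⊆ S`,
`Σ_{s ∈ s₀} w_s^p B_s` is a `v`-unit whenever the `w_s ∈ O` are not all in `𝔪_v` on `s₀`.  For `B = b` a `p`-spanning family of `k ⊆ O`
this says (MacLane) that `κ_v/k` is SEPARABLE and `b` stays `p`-independent in `κ_v`. [folklore] -/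
def ResiduallyPIndependentFamilyInf (p : ℕ) {K : Type} [Field K] (O : ValuationSubring K) {S : Type} (B : S → K) : Prop :=
    ∀ (s : Finset S) (w : S → K), (∀ i, w i ∈ O) → (∃ i ∈ s, O.valuation (w i) = 1) →
      O.valuation (∑ i ∈ s, w i ^ p * B i) = 1

/-- **THEOREM T′_∞'s slice**: `stub_cleanLU3DefectNonDiscrete` at `p` on {`[Γ : pΓ] = p²`, `K/k` separably generated, `k` of ARBITRARY
(possibly infinite) `p`-rank carrying a `p`-spanning family residually `p`-independent along `v`} — NO `PerfectField k`, NO finiteness of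
`[k : k^p]`. [folklore] -/
def CleanLU3DefectPRankTwoSepInfAt (p : ℕ) : Prop :=
    ∀ (k : Type) [Field k] [CharP k p] (K : Type) [Field K] [Algebra k K]
    (O : ValuationSubring K) (A : Subalgebra k K), A.toSubring ≤ O.toSubring → A.FG → IsFractionRing A K →
    ringKrullDim A ≤ 3 → IsRegularLocalRing (locAtCentre A.toSubring O) →
    ringKrullDim (locAtCentre A.toSubring O) = 3 →
    (∀ (T : Subring K) (hT : T ≤ O.toSubring), A.toSubring ≤ T → (subringCentre T O hT).IsMaximal) →
    ∀ g₀ : K, (∀ c : K, c ^ p ≠ g₀) →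
    (∀ f₀ : K, ∃ f₁ : K, O.valuation (g₀ - f₁ ^ p) < O.valuation (g₀ - f₀ ^ p)) →
    (∀ hk : ∀ c : k, algebraMap k K c ∈ O, transcendenceDefect k O hk ≠ 0) →
    ¬ (∃ π : K, π ≠ 0 ∧ (∀ x : K, O.valuation x < 1 → O.valuation x ≤ O.valuation π) ∧
      (∀ x : K, x ≠ 0 → ∃ n : ℕ, O.valuation π ^ n ≤ O.valuation x)) →
    PRankTwoAt p O → SepGenerated k K →
    ∀ (S : Type) (b : S → k), IsPSpanningFamilyInf p b →
    ResiduallyPIndependentFamilyInf p O (fun s => algebraMap k K (b s)) →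
    CleanLUConcl p k K O A g₀

/-- Restriction of a residually `p`-independent family to a finite subfamily (the finite notion of §B′ on the subtype `↥s`). [folklore] -/
theorem residuallyPIndependentFamily_restrict {p : ℕ} {K : Type} [Field K] (O : ValuationSubring K) {S : Type} (B : S → K)
    (hPI : ResiduallyPIndependentFamilyInf p O B) (s : Finset S) :
    ResiduallyPIndependentFamily p O (fun i : ↥s => B i) := by
  classical
  intro w hw hw1
  let w' : S → K := fun j => if h : j ∈ s then w ⟨j, h⟩ else 0
  have hw'in : ∀ i : ↥s, w' i = w i := fun i => by
    show (if h : (i : S) ∈ s then w ⟨i, h⟩ else 0) = w i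
    rw [dif_pos i.2]
  have hw'out : ∀ j, j ∉ s → w' j = 0 := fun j hj => by
    show (if h : j ∈ s then w ⟨j, h⟩ else 0) = 0
    rw [dif_neg hj]
  have hsum : ∑ i : ↥s, w i ^ p * B i = ∑ j ∈ s, w' j ^ p * B j := by
    rw [← Finset.sum_coe_sort s]
    exact Finset.sum_congr rfl fun i _ => by rw [hw'in i]
  rw [hsum]
  refine hPI s w' (fun j => ?_) ?_
  · by_cases h : j ∈ s
    · rw [show w' j = w ⟨j, h⟩ from hw'in ⟨j, h⟩]; exact hw _
    · rw [hw'out j h]; exact O.zero_mem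
  · obtain ⟨i, hi⟩ := hw1
    exact ⟨i, i.2, by rw [hw'in i]; exact hi⟩

/-- A finite `p`-spanning family (§B′) is a `p`-spanning family in the sense of §B″. [folklore] -/
theorem isPSpanningFamilyInf_of_fintype {p : ℕ} {k : Type} [Field k] {S : Type} [Fintype S] (b : S → k)
    (hb : IsPSpanningFamily p b) : IsPSpanningFamilyInf p b := fun c => by
  obtain ⟨d, hd⟩ := hb c
  exact ⟨Finset.univ, d, hd⟩

/-- A finite residually `p`-independent family (§B′) is residually `p`-independent in the sense of §B″ (`p ≠ 0`). [folklore] -/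
theorem residuallyPIndependentFamilyInf_of_fintype {p : ℕ} (hp : p ≠ 0) {K : Type} [Field K] (O : ValuationSubring K)
    {S : Type} [Fintype S] (B : S → K) (hPI : ResiduallyPIndependentFamily p O B) :
    ResiduallyPIndependentFamilyInf p O B := by
  classical
  intro s w hw hw1
  let w' : S → K := fun j => if j ∈ s then w j else 0
  have hin : ∀ j ∈ s, w' j = w j := fun j hj => by
    show (if j ∈ s then w j else 0) = w j
    rw [if_pos hj]
  have hout : ∀ j, j ∉ s → w' j = 0 := fun j hj => by
    show (if j ∈ s then w j else 0) = 0
    rw [if_neg hj]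
  have hsum : ∑ j ∈ s, w j ^ p * B j = ∑ j : S, w' j ^ p * B j := by
    have h1 : ∑ j ∈ s, w' j ^ p * B j = ∑ j : S, w' j ^ p * B j :=
      Finset.sum_subset (Finset.subset_univ s) (fun j _ hj => by rw [hout j hj, zero_pow hp, zero_mul])
    rw [← h1]
    exact Finset.sum_congr rfl fun j hj => by rw [hin j hj]
  rw [hsum]
  refine hPI w' (fun j => ?_) ?_
  · by_cases h : j ∈ s
    · rw [hin j h]; exact hw _
    · rw [hout j h]; exact O.zero_mem
  · obtain ⟨i, hi, hvi⟩ := hw1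
    exact ⟨i, by rw [hin i hi]; exact hvi⟩



/-! ### Currency of THEOREM T″ (`Lens5_TPrimeInfCurrency.lean` §I) and of THEOREM T‴ (`Lens5_TPrimeConst.lean` §1) -/

/-- **THEOREM T″'s slice**: `stub_cleanLU3DefectNonDiscrete` at `p` on {`[Γ : pΓ] = p²`, `K/k` separably generated, `κ_v/k` SEPARABLE} — the
last condition stated with Mathlib's `Algebra.IsSeparable` for any `k`-algebra structure on `κ_v = IsLocalRing.ResidueField O` compatible with
`k → O → κ_v`; NO `PerfectField k`, NO finiteness of `[k : k^p]`, NO auxiliary family. [folklore] -/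
def CleanLU3DefectPRankTwoSepResAt (p : ℕ) : Prop :=
    ∀ (k : Type) [Field k] [CharP k p] (K : Type) [Field K] [Algebra k K]
    (O : ValuationSubring K) (A : Subalgebra k K), A.toSubring ≤ O.toSubring → A.FG → IsFractionRing A K →
    ringKrullDim A ≤ 3 → IsRegularLocalRing (locAtCentre A.toSubring O) →
    ringKrullDim (locAtCentre A.toSubring O) = 3 →
    (∀ (T : Subring K) (hT : T ≤ O.toSubring), A.toSubring ≤ T → (subringCentre T O hT).IsMaximal) →
    ∀ g₀ : K, (∀ c : K, c ^ p ≠ g₀) →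
    (∀ f₀ : K, ∃ f₁ : K, O.valuation (g₀ - f₁ ^ p) < O.valuation (g₀ - f₀ ^ p)) →
    (∀ hk : ∀ c : k, algebraMap k K c ∈ O, transcendenceDefect k O hk ≠ 0) →
    ¬ (∃ π : K, π ≠ 0 ∧ (∀ x : K, O.valuation x < 1 → O.valuation x ≤ O.valuation π) ∧
      (∀ x : K, x ≠ 0 → ∃ n : ℕ, O.valuation π ^ n ≤ O.valuation x)) →
    PRankTwoAt p O → SepGenerated k K →
    ∀ [Algebra k (IsLocalRing.ResidueField O)],
      (∀ (c : k) (h : algebraMap k K c ∈ O),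
        algebraMap k (IsLocalRing.ResidueField O) c = IsLocalRing.residue O ⟨algebraMap k K c, h⟩) →
      Algebra.IsSeparable k (IsLocalRing.ResidueField O) →
    CleanLUConcl p k K O A g₀

/-- **THEOREM T‴'s slice**: `stub_cleanLU3DefectNonDiscrete` at `p` on {`[Γ : pΓ] = p²`} × {for SOME intermediate field `k'` of `K/k`
finite over `k`: `K/k'` separably generated and `κ_v/k'` separable (for any compatible `k'`-algebra structure on `κ_v`)}.  The case
`k' = k` (i.e. `⊥`) is T″; the new content is an inseparable finite field of constants `k' ⊋ k`. Conclusion over the ORIGINAL `k`. [folklore] -/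
def CleanLU3DefectPRankTwoSepConstAt (p : ℕ) : Prop :=
    ∀ (k : Type) [Field k] [CharP k p] (K : Type) [Field K] [Algebra k K]
    (O : ValuationSubring K) (A : Subalgebra k K), A.toSubring ≤ O.toSubring → A.FG → IsFractionRing A K →
    ringKrullDim A ≤ 3 → IsRegularLocalRing (locAtCentre A.toSubring O) →
    ringKrullDim (locAtCentre A.toSubring O) = 3 →
    (∀ (T : Subring K) (hT : T ≤ O.toSubring), A.toSubring ≤ T → (subringCentre T O hT).IsMaximal) →
    ∀ g₀ : K, (∀ c : K, c ^ p ≠ g₀) →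
    (∀ f₀ : K, ∃ f₁ : K, O.valuation (g₀ - f₁ ^ p) < O.valuation (g₀ - f₀ ^ p)) →
    (∀ hk : ∀ c : k, algebraMap k K c ∈ O, transcendenceDefect k O hk ≠ 0) →
    ¬ (∃ π : K, π ≠ 0 ∧ (∀ x : K, O.valuation x < 1 → O.valuation x ≤ O.valuation π) ∧
      (∀ x : K, x ≠ 0 → ∃ n : ℕ, O.valuation π ^ n ≤ O.valuation x)) →
    PRankTwoAt p O →
    ∀ (k' : IntermediateField k K), FiniteDimensional k k' → SepGenerated k' K →
    ∀ [Algebra k' (IsLocalRing.ResidueField O)],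
      (∀ (c : k') (h : algebraMap k' K c ∈ O),
        algebraMap k' (IsLocalRing.ResidueField O) c = IsLocalRing.residue O ⟨algebraMap k' K c, h⟩) →
      Algebra.IsSeparable k' (IsLocalRing.ResidueField O) →
    CleanLUConcl p k K O A g₀

end Summit.ResolutionOfSingularities.ResolutionOfSingularities.Theorems.RadicialJungCleanModels.Lens5TFrame

end
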